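import Mathlib
import Summits.Ventures.PercRepro2.Defs
import Summits.Ventures.PercRepro2.Independence
import Summits.Ventures.PercRepro2.Harris
import Summits.Ventures.PercRepro2.Graph
import Summits.Ventures.PercRepro2.Events
import Summits.Ventures.PercRepro2.RootCutSupport

/-!
# A cut vertex separating the roots, mixed placement: the class, side events and the dictionary
(blind cell PercRepro2, mine-2 g20; proofs/MINE2-CUTU.md §7 Theorem 6 case (3), M2-42 addendum)

Definitions and lemmas for `CutMixedPM.lean` (the two per-side theorems).

The host `u` is a cut vertex separating the roots: the graph splits into a side `VL ∋ a₁, o` and a side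
`VH ∋ a₂, b` meeting only in `u` (`CutSep`).  Every connection is read off the two side restrictions
(`conn_side` / `conn_cross` of `RootCutSupport.lean`), the side events are independent (disjoint edge sets),
and both per-side brackets of the weighted (PM) (`Q = {a₁ ↮ a₂}`, multiplied out by `P(Q)³`, the same cleared
forms as in `LeafRootPM.lean` / `LeafRootPMH.lean`) are PRODUCTS of nonnegative side masses:

  `P(Q)³ · (HALF-PM⁺)_L = β · t_u · ȳ_b · [(1 − β) C_ou + β (1 − t_u) x_o]`,
  `P(Q)³ · (HALF-PM⁺)_H = t_u · Cov_VH(B, Z_b) · [(1 − β) C_ou + β (1 − t_u) x_o]`,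

with `A = {a₁ ↔ u in VL}`, `t_u = P(A)`, `C_ou = P(L_o A) − P(A) P(L_o) ≥ 0` (Harris), `x_o = P({u ↔ o in VL} Aᶜ)`,
`B = {u ↔ a₂ in VH}`, `β = P(B)`, `ȳ_b = P({u ↔ b in VH} Bᶜ)`, `Cov_VH(B, Z_b) = P(Z_b B) − P(Z_b) P(B) ≥ 0`
(Harris; `Z_b = {a₂ ↔ b in VH}`).  Theorems `halfL_mixed_nonneg`, `halfH_mixed_nonneg`.  Together with the leaf
class (both marks on one side) and the mirrors under `a₁ ↔ a₂`, this is the per-side content of Theorem 6: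
the weighted (PM) holds whenever the host is an unmarked cut vertex separating the roots (the step to `β₁`
itself is paper).  Typed version: not claimed.
-/

namespace Summit.Ventures.PercRepro2

namespace CutMixedPM

open CovForm.RootBridge

section Class

variable {V : Type*} {E : Type*}

/-- **The host `u` is a cut vertex separating the roots, mixed placement**: sides `VL ∋ a₁, o` and
`VH ∋ a₂, b` meeting only in `u`; every edge lies within one side, none within both. -/
structure CutSep (ends : E → Sym2 V) (a₁ o a₂ b u : V) (VL VH : Set V) : Prop where
  split : ∀ e, e ∈ within ends VL ∨ e ∈ within ends VH
  cap : ∀ t, t ∈ VL → t ∈ VH → t = u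
  noloop : ∀ e, ¬ (e ∈ within ends VL ∧ e ∈ within ends VH)
  uL : u ∈ VL
  uH : u ∈ VH
  a1L : a₁ ∈ VL
  oL : o ∈ VL
  a2H : a₂ ∈ VH
  bH : b ∈ VH
  a1u : a₁ ≠ u
  ou : o ≠ u
  a2u : a₂ ≠ u
  bu : b ≠ u

/-- The connection event read inside the side `W`. -/
def CW (ends : E → Sym2 V) (W : Set V) (x y : V) : Set (Config E) :=
  {ω | Conn ends (withinRestr ends W ω) x y}

variable {ends : E → Sym2 V} {W : Set V}

/-- Membership in `CW`. -/
lemma mem_CW {x y : V} {ω : Config E} :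
    ω ∈ CW ends W x y ↔ Conn ends (withinRestr ends W ω) x y := Iff.rfl

/-- `CW` is symmetric. -/
lemma CW_comm (x y : V) : CW ends W x y = CW ends W y x := by
  ext ω; simp only [CW, Set.mem_setOf_eq]; exact ⟨conn_symm, conn_symm⟩

/-- `CW` is determined by the edges within `W`. -/
lemma dependsOn_CW (x y : V) : DependsOn (· ∈ CW ends W x y) (within ends W) := by
  intro ω ω' h
  have : withinRestr ends W ω = withinRestr ends W ω' := by
    funext e
    unfold withinRestr
    by_cases he : e ∈ within ends W
    · simp [he, h e he]
    · simp [he]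
  show (ω ∈ CW ends W x y) = (ω' ∈ CW ends W x y)
  simp only [CW, Set.mem_setOf_eq, this]

/-- `CW` is an increasing event. -/
lemma isUpperSet_CW (x y : V) : IsUpperSet (CW ends W x y) := by
  intro ω ω' h hω
  simp only [CW, Set.mem_setOf_eq] at hω ⊢
  refine conn_mono ?_ hω
  intro e
  unfold withinRestr
  by_cases he : e ∈ within ends W
  · simp only [he, if_true]; exact h e
  · simp [he]

/-- Transitivity through the common vertex: `{a₁ ↔ o} ∩ {u ↔ o} ⊆ {a₁ ↔ u}` inside `W`. -/
lemma CW_inter_subset (x y z : V) : CW ends W x y ∩ CW ends W z y ⊆ CW ends W x z :=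
  fun _ h => conn_trans h.1 (conn_symm h.2)

end Class

section Dictionary

variable {V : Type*} {E : Type*} {ends : E → Sym2 V} {a₁ o a₂ b u : V} {VL VH : Set V}

/-- Every open edge lies within one side (from `split`). -/
lemma hx_of (hc : CutSep ends a₁ o a₂ b u VL VH) (x : Config E) :
    ∀ e, x e = true → e ∈ within ends VL ∨ e ∈ within ends VH := fun e _ => hc.split e

/-- A connection inside `VL` between two vertices of `VL` is read in the restriction. -/
lemma connEvent_eq_CW_L (hc : CutSep ends a₁ o a₂ b u VL VH) {x y : V} (hx : x ∈ VL) (hy : y ∈ VL) :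
    connEvent ends x y = CW ends VL x y := by
  ext ω
  simp only [mem_connEvent, CW, Set.mem_setOf_eq]
  exact conn_side ends (hx_of hc ω) hc.cap hx hy

/-- A connection inside `VH` between two vertices of `VH` is read in the restriction. -/
lemma connEvent_eq_CW_H (hc : CutSep ends a₁ o a₂ b u VL VH) {x y : V} (hx : x ∈ VH) (hy : y ∈ VH) :
    connEvent ends x y = CW ends VH x y := by
  ext ω
  simp only [mem_connEvent, CW, Set.mem_setOf_eq]
  exact conn_side ends (fun e he => (hx_of hc ω e he).symm) (fun t h1 h2 => hc.cap t h2 h1) hx hy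

/-- A connection from `VL` to `VH ∖ {u}` passes through `u`. -/
lemma connEvent_eq_cross_LH (hc : CutSep ends a₁ o a₂ b u VL VH) {x y : V} (hx : x ∈ VL) (hy : y ∈ VH)
    (hyu : y ≠ u) : connEvent ends x y = CW ends VL x u ∩ CW ends VH u y := by
  ext ω
  simp only [mem_connEvent, Set.mem_inter_iff, CW, Set.mem_setOf_eq]
  exact conn_cross ends (hx_of hc ω) hc.cap ⟨hc.uL, hc.uH⟩ hx hy hyu

/-- A connection from `VH` to `VL ∖ {u}` passes through `u`. -/
lemma connEvent_eq_cross_HL (hc : CutSep ends a₁ o a₂ b u VL VH) {x y : V} (hx : x ∈ VH) (hy : y ∈ VL)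
    (hyu : y ≠ u) : connEvent ends x y = CW ends VH x u ∩ CW ends VL u y := by
  ext ω
  simp only [mem_connEvent, Set.mem_inter_iff, CW, Set.mem_setOf_eq]
  exact conn_cross ends (fun e he => (hx_of hc ω e he).symm) (fun t h1 h2 => hc.cap t h2 h1)
    ⟨hc.uH, hc.uL⟩ hx hy hyu

/-- The two sides carry disjoint edge sets. -/
lemma disjoint_within (hc : CutSep ends a₁ o a₂ b u VL VH) :
    Disjoint (within ends VL) (within ends VH) :=
  Set.disjoint_left.2 fun e h1 h2 => hc.noloop e ⟨h1, h2⟩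

end Dictionary

section DepHelpers

variable {E : Type*}

/-- Events determined by `F` are closed under `∩`. -/
lemma depI {F : Set E} {A B : Set (Config E)} (hA : DependsOn (· ∈ A) F)
    (hB : DependsOn (· ∈ B) F) : DependsOn (· ∈ A ∩ B) F := by
  simpa using dependsOn_inter hA hB

/-- Events determined by `F` are closed under `∪`. -/
lemma depU {F : Set E} {A B : Set (Config E)} (hA : DependsOn (· ∈ A) F)
    (hB : DependsOn (· ∈ B) F) : DependsOn (· ∈ A ∪ B) F := by
  simpa using dependsOn_union hA hB

end DepHelpers

section SetAlgebra

variable {X : Type*}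

/-- Set algebra: `A ∩ Y ∩ (A ∩ B)ᶜ = A ∩ (Y ∩ Bᶜ)`. -/
lemma set_m2 (A Y B : Set X) : A ∩ Y ∩ (A ∩ B)ᶜ = A ∩ (Y ∩ Bᶜ) := by
  ext; simp only [Set.mem_inter_iff, Set.mem_compl_iff]; tauto

/-- Set algebra: `B ∩ (A ∩ B)ᶜ = Aᶜ ∩ B`. -/
lemma set_m3 (A B : Set X) : B ∩ (A ∩ B)ᶜ = Aᶜ ∩ B := by
  ext; simp only [Set.mem_inter_iff, Set.mem_compl_iff]; tauto

/-- Set algebra: `A ∩ Y ∩ B ∩ (A ∩ B)ᶜ = ∅`. -/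
lemma set_m4 (A Y B : Set X) : A ∩ Y ∩ B ∩ (A ∩ B)ᶜ = ∅ := by
  ext; simp only [Set.mem_inter_iff, Set.mem_compl_iff, Set.mem_empty_iff_false]; tauto

/-- Set algebra: `(Lo ∪ B ∩ Xo) ∩ (A ∩ B)ᶜ = (Lo ∩ (A ∩ B)ᶜ) ∪ ((Xo ∩ Aᶜ) ∩ B)`. -/
lemma set_m5 (Lo Xo A B : Set X) :
    (Lo ∪ B ∩ Xo) ∩ (A ∩ B)ᶜ = (Lo ∩ (A ∩ B)ᶜ) ∪ ((Xo ∩ Aᶜ) ∩ B) := by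
  ext; simp only [Set.mem_inter_iff, Set.mem_compl_iff, Set.mem_union]; tauto

/-- Set algebra: `Lo ∩ (A ∩ B) = (Lo ∩ A) ∩ B`. -/
lemma set_m5' (Lo A B : Set X) : Lo ∩ (A ∩ B) = (Lo ∩ A) ∩ B := by
  ext; simp only [Set.mem_inter_iff]; tauto

/-- Set algebra: `B ∩ (Lo ∪ B ∩ Xo) ∩ (A ∩ B)ᶜ = ((Lo ∪ Xo) ∩ Aᶜ) ∩ B`. -/
lemma set_m6 (Lo Xo A B : Set X) : B ∩ (Lo ∪ B ∩ Xo) ∩ (A ∩ B)ᶜ = ((Lo ∪ Xo) ∩ Aᶜ) ∩ B := by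
  ext; simp only [Set.mem_inter_iff, Set.mem_compl_iff, Set.mem_union]; tauto

/-- Set algebra: `(Lo ∪ Xo) ∩ Aᶜ = (Lo ∩ Aᶜ) ∪ (Xo ∩ Aᶜ)`. -/
lemma set_m6' (Lo Xo A : Set X) : (Lo ∪ Xo) ∩ Aᶜ = (Lo ∩ Aᶜ) ∪ (Xo ∩ Aᶜ) := by
  ext; simp only [Set.mem_inter_iff, Set.mem_compl_iff, Set.mem_union]; tauto

/-- Set algebra: `A ∩ Y ∩ B ∩ (Lo ∪ B ∩ Xo) ∩ (A ∩ B)ᶜ = ∅`. -/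
lemma set_m7 (A Y B Lo Xo : Set X) : A ∩ Y ∩ B ∩ (Lo ∪ B ∩ Xo) ∩ (A ∩ B)ᶜ = ∅ := by
  ext; simp only [Set.mem_inter_iff, Set.mem_compl_iff, Set.mem_union, Set.mem_empty_iff_false]; tauto

/-- Set algebra: `B ∩ Xo ∩ (A ∩ B)ᶜ = (Xo ∩ Aᶜ) ∩ B`. -/
lemma set_m8 (Xo A B : Set X) : B ∩ Xo ∩ (A ∩ B)ᶜ = (Xo ∩ Aᶜ) ∩ B := by
  ext; simp only [Set.mem_inter_iff, Set.mem_compl_iff]; tauto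

/-- Set algebra: `A ∩ Y ∩ (B ∩ Xo) ∩ (A ∩ B)ᶜ = ∅`. -/
lemma set_m9 (A Y B Xo : Set X) : A ∩ Y ∩ (B ∩ Xo) ∩ (A ∩ B)ᶜ = ∅ := by
  ext; simp only [Set.mem_inter_iff, Set.mem_compl_iff, Set.mem_empty_iff_false]; tauto

/-- Set algebra: `Zb ∩ (A ∩ B) = A ∩ (Zb ∩ B)`. -/
lemma set_h1 (Zb A B : Set X) : Zb ∩ (A ∩ B) = A ∩ (Zb ∩ B) := by
  ext; simp only [Set.mem_inter_iff]; tauto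

/-- Set algebra: `A ∩ (A ∩ B)ᶜ = A ∩ Bᶜ`. -/
lemma set_h2 (A B : Set X) : A ∩ (A ∩ B)ᶜ = A ∩ Bᶜ := by
  ext; simp only [Set.mem_inter_iff, Set.mem_compl_iff]; tauto

/-- Set algebra: `Zb ∩ A ∩ (A ∩ B)ᶜ = A ∩ (Zb ∩ Bᶜ)`. -/
lemma set_h3 (Zb A B : Set X) : Zb ∩ A ∩ (A ∩ B)ᶜ = A ∩ (Zb ∩ Bᶜ) := by
  ext; simp only [Set.mem_inter_iff, Set.mem_compl_iff]; tauto

/-- Set algebra: `Zb ∩ Lo ∩ (A ∩ B) = (Lo ∩ A) ∩ (Zb ∩ B)`. -/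
lemma set_h5 (Zb Lo A B : Set X) : Zb ∩ Lo ∩ (A ∩ B) = (Lo ∩ A) ∩ (Zb ∩ B) := by
  ext; simp only [Set.mem_inter_iff]; tauto

/-- Set algebra: `A ∩ (Lo ∪ B ∩ Xo) ∩ (A ∩ B)ᶜ = (Lo ∩ A) ∩ Bᶜ`. -/
lemma set_h7 (Lo Xo A B : Set X) : A ∩ (Lo ∪ B ∩ Xo) ∩ (A ∩ B)ᶜ = (Lo ∩ A) ∩ Bᶜ := by
  ext; simp only [Set.mem_inter_iff, Set.mem_compl_iff, Set.mem_union]; tauto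

/-- Set algebra: `Zb ∩ A ∩ (Lo ∪ B ∩ Xo) ∩ (A ∩ B)ᶜ = (Lo ∩ A) ∩ (Zb ∩ Bᶜ)`. -/
lemma set_h8 (Zb Lo Xo A B : Set X) :
    Zb ∩ A ∩ (Lo ∪ B ∩ Xo) ∩ (A ∩ B)ᶜ = (Lo ∩ A) ∩ (Zb ∩ Bᶜ) := by
  ext; simp only [Set.mem_inter_iff, Set.mem_compl_iff, Set.mem_union]; tauto

end SetAlgebra

end CutMixedPM

end Summit.Ventures.PercRepro2
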